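import Literature.AlgebraicGeometry.Motives.HodgeDecompositionProofs
import Literature.NumberTheory.Transcendental.KaehlerIdentityDolbeaultVanishingProofs

/-!
# Discharge of `mk_mem_hodgePQ_of_mem_dolbeaultHarmonicForms` (Voisin (2002), §6.1.3 Prop. 6.11)

The named fact `Literature.AlgebraicGeometry.Motives.mk_mem_hodgePQ_of_mem_dolbeaultHarmonicForms g o`
of `HodgeDecomposition.lean` (hodge.S07, the converse inclusion `ℋ^{p,q} → H^{p,q}`: on a compact
Kähler manifold the de Rham class of a `∂̄`-harmonic `(p,q)`-form lies in `hodgePQ E M k p q`) is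
**proved** here (`mk_mem_hodgePQ_of_mem_dolbeaultHarmonicForms_holds`).

Source and proof. C. Voisin, *Hodge Theory and Complex Algebraic Geometry I* (2002), §6.1.3,
proof of Prop. 6.11 (PDF p. 121): a `∂̄`-harmonic form is `∂̄`-closed and `∂̄*`-closed
(Cor. 5.13; the tree's `dolbeaultBar_eq_zero_of_mem_dolbeaultHarmonicForms`,
`isDolbeaultHarmonic_iff_of_inner_tangentJ`), and on a compact Kähler manifold also `∂`-closed —
Voisin deduces this from `Δ_d = 2Δ_∂̄` (Thm. 6.7), itself a consequence of the Kähler identities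
(Prop. 6.5, Lemma 6.6); here the step "`∂̄`-harmonic ⇒ `∂`-closed" is taken directly from the
first-order identity `[∂̄*, L] = i∂` proved in
`KaehlerIdentityAssemblyProofs.lean` (Voisin's osculation argument, Prop. 3.14 + Lemma 6.6), via
`dolbeault_eq_zero_of_dolbeaultBar_harmonic` and its degree variants
(`KaehlerIdentityDolbeaultVanishingProofs.lean`). Hence `dα = ∂α + ∂̄α = 0`, and the class of the
closed `(p,q)`-form `α` is a generator of `hodgePQ` (as in the relative discharge
`mk_mem_hodgePQ_of_mem_dolbeaultHarmonicForms_of`).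

## References

* C. Voisin, *Hodge Theory and Complex Algebraic Geometry I* (2002), Prop. 3.14, Cor. 5.13,
  §6.1.1 Prop. 6.5, Lemma 6.6, §6.1.2 Cor. 6.10, §6.1.3 Prop. 6.11 (PDF p. 121). [Voisin2002]
-/

noncomputable section

open scoped Manifold ContDiff Topology RealInnerProductSpace
open Bundle Module Set Finset Complex

namespace Literature.AlgebraicGeometry.Motives

open Literature.Geometry.Kaehler Literature.NumberTheory.Transcendental

variable {E : Type*} [NormedAddCommGroup E] [NormedSpace ℂ E]
  {M : Type*} [TopologicalSpace M] [ChartedSpace E M]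
  [FiniteDimensional ℂ E] [IsManifold 𝓘(ℝ, E) ∞ M] {n : ℕ} [Fact (finrank ℝ E = n)]
  (g : ContMDiffRiemannianMetric 𝓘(ℝ, E) ∞ E (fun x : M ↦ TangentSpace 𝓘(ℝ, E) x))
  (o : (x : M) → Orientation ℝ (TangentSpace 𝓘(ℝ, E) x) (Fin n))

set_option maxHeartbeats 800000 in
/-- **`∂̄`-harmonic forms on a compact Kähler manifold are `∂`-closed** (Voisin (2002), §6.1.2,
Cor. 6.10 with Cor. 5.13), for the smooth Kähler metric `g` installed as the Riemannian structure:
if `α` is `∂̄`-harmonic of type `(p,q)` then `∂α = 0`. By degree: functions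
(`dolbeault_eq_zero_of_dolbeaultBar_eq_zero_zero`), degrees `≤ n - 2`
(`dolbeault_eq_zero_of_dolbeaultBar_harmonic`), degree `n - 1`
(`dolbeault_eq_zero_of_dolbeaultBar_harmonic_edge`), degree `n` (no `(n+1)`-forms).
[cite: Voisin2002, §6.1.2 Cor. 6.10] -/
theorem dolbeault_eq_zero_of_isDolbeaultHarmonic [IsManifold 𝓘(ℂ, E) ω M] [CompactSpace M]
    [T2Space M] (hg : g.toRiemannianMetric.IsKaehler) {k p q m : ℕ} (h : k + m = n)
    {α : MForm 𝓘(ℝ, E) M ℂ k} :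
    letI : RiemannianBundle (fun x : M ↦ TangentSpace 𝓘(ℝ, E) x) := ⟨g.toRiemannianMetric⟩
    IsSmoothForm (riemannianVolumeForm o) → IsDolbeaultHarmonic o p q h α → dolbeault α = 0 := by
  letI : RiemannianBundle (fun x : M ↦ TangentSpace 𝓘(ℝ, E) x) := ⟨g.toRiemannianMetric⟩
  haveI : IsContMDiffRiemannianBundle 𝓘(ℝ, E) ∞ E (fun x : M ↦ TangentSpace 𝓘(ℝ, E) x) :=
    ⟨g.inner, g.contMDiff, fun _ _ _ ↦ rfl⟩
  haveI : IsContinuousRiemannianBundle E (fun x : M ↦ TangentSpace 𝓘(ℝ, E) x) :=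
    ⟨g.inner, g.contMDiff.continuous, fun _ _ _ ↦ rfl⟩
  intro ho hH
  -- the metric as a family of bilinear forms on the model space
  have hJ : ∀ (x : M) (v w : TangentSpace 𝓘(ℝ, E) x), ⟪tangentJ E x v, tangentJ E x w⟫ = ⟪v, w⟫ :=
    fun x v w ↦ hg.isHermitian x v w
  set G : M → E →L[ℝ] E →L[ℝ] ℝ := fun x ↦ (g.inner x : E →L[ℝ] E →L[ℝ] ℝ) with hGdef
  have hG : ∀ (x : M) (v w : TangentSpace 𝓘(ℝ, E) x), G x v w = ⟪v, w⟫ := fun _ _ _ ↦ rfl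
  have hHG : ∀ x v w, G x (Complex.I • v) (Complex.I • w) = G x v w := fun x v w ↦ hg.isHermitian x v w
  have hK := hg.isClosedForm_kaehlerForm
  have hn : Even n := (Fact.out : finrank ℝ E = n) ▸ even_finrank_real E
  rcases k with - | k
  · -- functions
    have hdb : dolbeaultBar α = 0 :=
      dolbeaultBar_eq_zero_of_isDolbeaultHarmonic_of_inner_tangentJ o hJ ho h hH
    rcases Nat.lt_or_ge n 2 with hn2 | hn2
    · exact cform_eq_zero_of_finrank_lt (n := n) (by obtain ⟨r, hr⟩ := hn; omega) _
    · exact dolbeault_eq_zero_of_dolbeaultBar_eq_zero_zero o hJ ho G hG hHG hK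
        (show (0 + 1 + 1) + (n - 2) = n by omega) hH.1 hdb
  · obtain ⟨hdb, hadj⟩ := (isDolbeaultHarmonic_iff_of_inner_tangentJ o hJ ho h hH.1 hH.2.1).1 hH
    rcases m with - | m
    · exact dolbeault_eq_zero_of_top h α
    rcases m with - | m
    · exact dolbeault_eq_zero_of_dolbeaultBar_harmonic_edge o hJ ho G hG hHG hK h hH.1 hadj
    · exact dolbeault_eq_zero_of_dolbeaultBar_harmonic o hJ ho G hG hHG hK
        (show (k + 1 + 1 + 1) + m = n by omega) h hH.1 hdb hadj

/-- **Discharge of the named fact `mk_mem_hodgePQ_of_mem_dolbeaultHarmonicForms`** (hodge.S07,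
Voisin (2002), §6.1.3, proof of Prop. 6.11, PDF p. 121: "obviously `H^{p,q} ⊂ K^{p,q}`"): on a
compact Kähler manifold the de Rham class of a `∂̄`-harmonic `(p,q)`-form lies in
`hodgePQ E M k p q`. The form is smooth, of type `(p,q)` and `∂̄`-closed
(`dolbeaultBar_eq_zero_of_mem_dolbeaultHarmonicForms`, Cor. 5.13) and `∂`-closed
(`dolbeault_eq_zero_of_isDolbeaultHarmonic` on the harmonic generators of the span, by the Kähler
identity `[∂̄*, L] = i∂`, Prop. 6.5), hence closed (`d = ∂ + ∂̄`), and its class is a generator of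
`hodgePQ`; if `p + q ≠ k` the space `ℋ^{p,q}` is `⊥`. [cite: Voisin2002, §6.1.3 Prop. 6.11] -/
theorem mk_mem_hodgePQ_of_mem_dolbeaultHarmonicForms_holds :
    mk_mem_hodgePQ_of_mem_dolbeaultHarmonicForms g o := by
  intro _ _ _ hg k p q m h α ho hα
  letI : RiemannianBundle (fun x : M ↦ TangentSpace 𝓘(ℝ, E) x) := ⟨g.toRiemannianMetric⟩
  by_cases hpq : p + q = k
  · obtain ⟨hs, ht, hdb⟩ := dolbeaultBar_eq_zero_of_mem_dolbeaultHarmonicForms g o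
      (fun {_} ↦ dolbeaultHarmonicForms_le_dolbeaultClosedForms_of_isManifold_complex g o)
      hg.isHermitian hpq h ho hα
    -- `∂α = 0`: the smooth `∂`-closed forms form a submodule containing the harmonic generators
    let S : Submodule ℂ (MForm 𝓘(ℝ, E) M ℂ k) :=
      { carrier := {β | IsSmoothForm β ∧ dolbeault β = 0}
        add_mem' := fun {a b} ha hb ↦ ⟨ha.1.add hb.1, by
          rw [dolbeault_add' ha.1 hb.1, ha.2, hb.2, add_zero]⟩
        zero_mem' := ⟨isSmoothForm_zero, dolbeault_zero⟩
        smul_mem' := fun c {β} hβ ↦ ⟨(mem_csmoothForms_iff _).1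
          ((csmoothForms E M k).smul_mem c (mem_csmoothForms hβ.1)), by
          rw [dolbeault_smul_holds c, hβ.2, smul_zero]⟩ }
    have hS : dolbeaultHarmonicForms o p q h ≤ S :=
      Submodule.span_le.2 fun β hβ ↦ ⟨hβ.1, dolbeault_eq_zero_of_isDolbeaultHarmonic g o hg h ho hβ⟩
    have hd : dolbeault α = 0 := (hS hα).2
    have hc : IsClosedForm α := by
      rw [IsClosedForm, mextDeriv_eq_dolbeault_add_dolbeaultBar_holds hs, hd, hdb, add_zero]
    exact ⟨mem_cclosedSmoothForms hs hc, Submodule.subset_span ⟨⟨α, _⟩, ht, rfl⟩⟩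
  · rw [dolbeaultHarmonicForms_eq_bot_of_ne o hpq h, Submodule.mem_bot] at hα
    subst hα
    refine ⟨zero_mem _, ?_⟩
    have h0 : (⟨0, zero_mem _⟩ : cclosedSmoothForms E M k) = 0 := rfl
    rw [h0, _root_.map_zero]
    exact zero_mem _

end Literature.AlgebraicGeometry.Motives
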